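import Summits.Ventures.HSemireg.TwoLevelObstructionExtension
import Summits.Ventures.HSemireg.AmplificationChainSigmaGluable
import Literature.AlgebraicGeometry.HodgeTheory.SemiregularityMapDinatural
import HarnessLib

/-!
# LINE 2 «summand obstruction» for crux H2 = stmt-HodgeConjecture-18881 `EightfoldBlochSeeds.BlochSeedDiscOne`
# (plan-lens-HodgeAV-oqh g3, lens = oqh; NEG-style lemma in HYPOTHESIS FORM, kernel-proved; suggested by the critic of
# record idea-crit-6 g3 «SUGGESTED cycle-2 contribution … the SUMMAND OBSTRUCTION LEMMA in hypothesis form» and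
# director-hodge g16 O5)

HONEST FRAMING. NOTHING HERE SAYS THAT HC ∕ HC_CM ∕ HC_AV ∕ W₆ HOLDS OR FAILS; HC_CM is not mentioned, let alone used;
nothing here is a statement about `stub_rung_pad4_seedAt`, `BlochSeedDiscOne` (18881) or b08 `LocalVHCAtCM`. This file
proves NO seed and kills NO census row by itself: it is the abstract, kernel-checked form of the obstruction that closed
this lens's LINE 1 «prym-pair-sheaf-door» (`falsified:NEG#7 (summand class obstruction)`, memo
`ideators/plan-lens-HodgeAV-oqh/line-1/F1-SUMMAND-OBSTRUCTION.md` ef00a928cc00e217, census DELTA D-20 of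
`pub-hsemireg/target-g6/CENSUS.md`) and of the split ∕ point-glued instances of transfer's ε-trace no-go
(`Cruxes/BlochSeedDiscOne/TorusCarrierTraceNoGo.md`, `TorusCarrierSheafDoor.lean` Part C), so that this whole CLASS of
cheap witnesses for the sheaf door D2 (`Summit.Ventures.HSemireg.HasBFSheafSeedAt`, predicate `IsISemiregular`) and for
the perfect-complex door (`gluableSigmaAdmissible`, predicate `HomComplex.IsISemiregularC`) is excluded ONCE, by a
theorem, instead of line by line. Generic homological algebra: no variety, torus, Prym or Hodge class is constructed; no
Literature FACT (`def … : Prop`) is declared or used; no instance, no notation; census-neutral.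

THE LEMMA (words). Let `ob` be any self-`Ext` class assigned to objects and NATURAL along a map `i : F → G`
(`i ∘ ob(G) = ob(F) ∘ i`; for `ob_κ = κ ∪ At` = the tree's `Contraction.ob` ∕ `obExt` this is the tree's theorem
`Contraction.ob_natural` ∕ `obExt_natural`, no hypothesis). If `i` has a retraction `r` (`i ≫ r = 𝟙`, e.g. `F` a direct
summand of `G`), then the CORNER `i ∘ ob(G) ∘ r` EQUALS `ob(F)` (`corner_eq_of_natural`). Hence
(1) `ob(F) ≠ 0 ⇒ ob(G) ≠ 0` (`ne_zero_of_natural_retract`) — an obstructed summand can never be cancelled by the rest;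
(2) on a finite biproduct `ob(⨁ N) = Σ_a π_a ∘ ob(N_a) ∘ ι_a` and `ob(⨁ N) = 0 ⇔ ∀ a, ob(N_a) = 0`
    (`eq_sum_of_natural`, `eq_zero_iff_of_natural`) — a split design is unobstructed along `κ` iff EVERY block is;
(3) SHEAF DOOR: if moreover the partial semiregularity map kills the total class, `σ_q(ob(G)) = 0` for all `q ∈ J`
    (DISPLAYED binder; on paper this is [BuchweitzFlenner2003, Cor. 4.3] `σ_q(ob_κ ℰ) = κ ⌟ ch_{q+1}(ℰ)` together with
    «`κ` is a Weil ∕ Hodge-preserving direction for `ch(G)`» — NOT asserted here), then `G` is NOT `J`-semiregular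
    (`not_isISemiregular_of_natural_retract`, `…_of_retract_ob`, `…_of_retract_obExt`, biproduct forms, and the
    σ-certified form `…_of_retract_sigma_ne` whose summand hypothesis is `σ_p(ob(F)) ≠ 0`, i.e. «`κ ⌟ ch_{p+1}(F) ≠ 0`»);
(3b) WITH BOTH HYPOTHESES AS VALUES OF `σ` (§2b, the critic's sentence verbatim): by the tree's DINATURALITY of `σ_q`
    ([BuchweitzFlenner2003, Cor. 4.8]; `SemiregularityMapDinatural.sigmaHigher_biprod_eq_add`) and the corner identities,
    **`σ_p(ob(F ⊞ F')) = σ_p(ob(F)) + σ_p(ob(F'))`** (`sigmaHigher_ob_biprod_eq_add` — the kernel shadow of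
    `κ ⌟ ch(F ⊕ F') = κ ⌟ ch(F) + κ ⌟ ch(F')`, no Chern character needed); hence `σ_p(ob(F)) ≠ 0 ∧ σ_J(ob(F ⊞ F')) = 0 ⟹
    F ⊞ F'` not `J`-semiregular (`not_isISemiregular_biprod_of_sigma_ne`), equivalently «`F ⊞ F'` `J`-semiregular with
    `σ_J`-invisible total obstruction ⟹ `σ_p(ob(F)) = 0` for EVERY `p` and every summand»
    (`sigmaHigher_ob_summand_eq_zero_of_isISemiregular`), and the two summands' `σ_p(ob)` are opposite whenever the total
    vanishes (`sigmaHigher_ob_summands_cancel`): cancellation across summands is forced AND useless;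
(4) COMPLEX DOOR: the same in the derived category for a retract `A` of `Q K•` and degree-2 shifted classes
    (`shiftCorner_eq_of_natural`, `not_isISemiregularC_of_retract_obstructed`, `not_gluableSigmaAdmissible_of_retracts`).
NEG-STYLE READING (the sentence for the census and for every lens line): «Weil-ness of `ch` CANNOT be bought by
cancellation across direct summands: a direct sum (of sheaves, of perfect complexes, a disjoint union of carriers
`𝒪_Z = ⊕ 𝒪_{Z_a}`, LINE 1's `S₀ ⊕ S₁^∨`) one of whose summands has `κ ⌟ ch(summand) ≠ 0` for some direction `κ` with
`κ ⌟ ch(total) = 0` is never `J`-semiregular, for any `J`.» For NON-split extensions the necessary condition is the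
strictly weaker THEOREM P already in the tree (`Contraction.exists_lower_and_upper`, `exists_lower_and_upper_of_extension`):
the summand lemma is its rigid split case, where no `η ∈ Extⁿ(E₋, E₊)` can absorb `ob(F)`. NEAREST TREE PRIOR ART:
`SemiregularityMapDinatural.lean` proves that direct summands of an `I`-semiregular bundle are `I`-semiregular and that the cross
`Ext²` vanish (`IsISemiregular.biprod_fst`, `IsISemiregular.eq_zero_of_biprod₁₂`); what it does not contain, and this file adds, is
the link to the OBSTRUCTION CLASS `ob_κ` (naturality ⇒ block restriction ⇒ `σ(ob)` additive ⇒ the summand lemma).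

§4 (R-a of this lens's FOUND-NOTHING-TABLE-g0, «THEOREM DD ⊆ σ», hypothesis form, pure linear algebra): for linear maps
`U →ᶠ V →ᵍ W` with `V` finite-dimensional, `dim V ≥ rank(g ∘ f)` always, and `dim V ≤ rank(g ∘ f)` forces `g` injective
and `f` surjective (`injective_and_surjective_of_finrank_le_finrank_range_comp`). DICTIONARY (displayed, not constructed):
`U` = first-order directions `T_A 𝔥_{2n}(h)`, `V = H¹(Z, N_Z)`, `W = H^{n+1}(A, Ω^{n−1})`, `f = ob_Z` (`κ ↦` the induced
first-order deformation class), `g` = Bloch's semiregularity map, `g ∘ f = (κ ↦ κ ⌟ [Z])` of rank `n(n+1)` for a W-alive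
lci `Z` ([Bloch1972, §4–7]; [BuchweitzFlenner2003, Cor. 4.3]); so `h¹(N_Z) ≥ n(n+1)` for every W-alive lci `Z`, and
THEOREM DD's hypothesis `h¹(N_Z) ≤ n² + n` ([Ran93, Cor. 3]; FOUND-NOTHING row 4, kit j178052 void at 53∕55 hubs) FORCES
Bloch-semiregularity — the DD door is a sub-door of (σ). The tree's `IsBlochSemiregular` is surjectivity on additive
carriers with no `finrank` at the pin, so §4 is stated over a division ring and not instantiated on real carriers.

CENSUS ROWS THIS LINE EXPLAINS ∕ EXPLOITS (req-36 rule; card `pub-hsemireg/hodge-bloch-bc5-plan/birth-v4.md` v4.21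
35df5d8b718bef10): D-20 (target-g6 CENSUS.md; Prym-pair carrier DECIDED NO = this lemma with `F = S₀`, oqh g2 F1); W16
(◇₈ r3 j305149 FINAL) and W18 (encoder ×2 j310554 + W′ j312296 UNSAT ×2 FINAL): by (2) any decomposable H₁-static design is
SAT iff each block is, so UNSAT certificates need only range over INDECOMPOSABLE designs and a SAT claim assembled from
blocks must exhibit each block's own class as `κ`-invisible — a pre-filter for the running ◇₁₀ rows W19 (G₁ j308425) ∕ W22
(g53 third code) and LINE 4 W20 (j310053), not a verdict on them; NEG #7 ∕ #13 of
`Summits/Ventures/HSemireg/WeilNonSplitSemiregularityObstruction.lean` (the summand's `c·θ³` is exactly a `κ`-visible block).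
-/

noncomputable section

set_option linter.dupNamespace false

namespace Summit.HodgeConjecture.HodgeConjecture.Cruxes.BlochSeedDiscOne.SummandObstruction

open CategoryTheory CategoryTheory.Abelian CategoryTheory.Limits AlgebraicGeometry
open Literature.AlgebraicGeometry.HodgeTheory Literature.AlgebraicGeometry.Modules
  Literature.AlgebraicGeometry.Motives
open Summit.Ventures.HSemireg Summit.Ventures.HSemireg.TwoLevelObstruction

/-! ## §0 The logical core: a corner functional sees a class that the partial semiregularity map does not -/

/-- **Abstract summand obstruction** (pure algebra): if an additive functional `c` ("the corner") is non-zero on `ob`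
while every `σ_q`, `q ∈ J`, vanishes on `ob`, then `(σ_q)_{q ∈ J}` is not jointly injective. [folklore] -/
theorem not_jointKernel_trivial_of_corner {M N : Type*} [AddCommGroup M] [AddCommGroup N] {Q : Type*}
    {H : Q → Type*} [∀ q, AddCommGroup (H q)] (J : Set Q) (σ : ∀ q, M →+ H q) (c : M →+ N) {ob : M}
    (hc : c ob ≠ 0) (hσ : ∀ q ∈ J, σ q ob = 0) : ¬ ∀ x : M, (∀ q ∈ J, σ q x = 0) → x = 0 :=
  fun h => hc (by rw [h ob hσ, map_zero])

/-! ## §1 Corners of natural self-classes along retracts (any abelian category with `Ext`) -/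

section Corner

universe w v u

variable {C : Type u} [Category.{v} C] [Abelian C] [HasExt.{w} C]

/-- **The corner** of a self-class `ω ∈ Extⁿ(G, G)` along `i : F → G`, `r : G → F`: `i ∘ ω ∘ r ∈ Extⁿ(F, F)`
(diagrammatic `Ext.comp`; for `G = ⨁ N`, `i = ι_a`, `r = π_a` this is the tree's `lowerSelfEntry ω a a`). [definition of
this file] -/
def corner {F G : C} (i : F ⟶ G) (r : G ⟶ F) {n : ℕ} (ω : Ext.{w} G G n) : Ext.{w} F F n :=
  ((Ext.mk₀ i).comp ω (zero_add n)).comp (Ext.mk₀ r) (add_zero n)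

omit [HasExt C] in
/-- The corner of `0` is `0`. [folklore] -/
theorem corner_zero [HasExt.{w} C] {F G : C} (i : F ⟶ G) (r : G ⟶ F) (n : ℕ) :
    corner i r (0 : Ext.{w} G G n) = 0 := by
  simp only [corner, Ext.comp_zero, Ext.zero_comp]

/-- The corner is additive. [folklore] -/
theorem corner_add {F G : C} (i : F ⟶ G) (r : G ⟶ F) {n : ℕ} (ω ω' : Ext.{w} G G n) :
    corner i r (ω + ω') = corner i r ω + corner i r ω' := by
  simp only [corner, Ext.comp_add, Ext.add_comp]

/-- The corner as an additive map `Extⁿ(G, G) →+ Extⁿ(F, F)`. [definition of this file] -/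
def cornerHom {F G : C} (i : F ⟶ G) (r : G ⟶ F) (n : ℕ) : Ext.{w} G G n →+ Ext.{w} F F n where
  toFun := corner i r
  map_zero' := corner_zero i r n
  map_add' := corner_add i r

/-- **KEY IDENTITY: natural self-classes restrict to retracts.** If `i ∘ ω_G = ω_F ∘ i` (naturality along `i`) and
`i ≫ r = 𝟙 F`, then the corner of `ω_G` along `(i, r)` IS `ω_F`. [folklore] -/
theorem corner_eq_of_natural {F G : C} {i : F ⟶ G} {r : G ⟶ F} (hir : i ≫ r = 𝟙 F) {n : ℕ}
    {ωF : Ext.{w} F F n} {ωG : Ext.{w} G G n}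
    (hnat : (Ext.mk₀ i).comp ωG (zero_add n) = ωF.comp (Ext.mk₀ i) (add_zero n)) :
    corner i r ωG = ωF := by
  simp only [corner, hnat, Ext.comp_assoc_of_third_deg_zero, Ext.mk₀_comp_mk₀, hir, Ext.comp_mk₀_id]

/-- **Summand obstruction, class form:** an obstructed retract obstructs the whole — `ω_F ≠ 0 ⇒ ω_G ≠ 0`. [folklore] -/
theorem ne_zero_of_natural_retract {F G : C} {i : F ⟶ G} {r : G ⟶ F} (hir : i ≫ r = 𝟙 F) {n : ℕ}
    {ωF : Ext.{w} F F n} {ωG : Ext.{w} G G n}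
    (hnat : (Ext.mk₀ i).comp ωG (zero_add n) = ωF.comp (Ext.mk₀ i) (add_zero n)) (hF : ωF ≠ 0) : ωG ≠ 0 := by
  rintro rfl
  exact hF (by rw [← corner_eq_of_natural hir hnat, corner_zero])

/-- The same identity in the other association, `i ∘ (ω_G ∘ r) = ω_F` — the shape in which the tree's dinaturality file
`SemiregularityMapDinatural.lean` writes diagonal blocks (`sigmaHigher_biprod_fst_inl`, `sigmaHigher_biprod_eq_add`). [folklore] -/
theorem conj_eq_of_natural {F G : C} {i : F ⟶ G} {r : G ⟶ F} (hir : i ≫ r = 𝟙 F) {n : ℕ}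
    {ωF : Ext.{w} F F n} {ωG : Ext.{w} G G n}
    (hnat : (Ext.mk₀ i).comp ωG (zero_add n) = ωF.comp (Ext.mk₀ i) (add_zero n)) :
    (Ext.mk₀ i).comp (ωG.comp (Ext.mk₀ r) (add_zero n)) (zero_add n) = ωF := by
  rw [← Ext.comp_assoc_of_third_deg_zero]
  exact corner_eq_of_natural hir hnat

/-- Binary biproduct, left summand: the corner of a natural class on `F ⊞ F'` along `(inl, fst)` is the class of `F`.
[folklore] -/
theorem corner_inl_fst_eq_of_natural {F F' : C} {n : ℕ} {ωF : Ext.{w} F F n} {ω : Ext.{w} (F ⊞ F') (F ⊞ F') n}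
    (hnat : (Ext.mk₀ (biprod.inl : F ⟶ F ⊞ F')).comp ω (zero_add n) = ωF.comp (Ext.mk₀ biprod.inl) (add_zero n)) :
    corner biprod.inl biprod.fst ω = ωF :=
  corner_eq_of_natural biprod.inl_fst hnat

/-- Binary biproduct, right summand. [folklore] -/
theorem corner_inr_snd_eq_of_natural {F F' : C} {n : ℕ} {ωF' : Ext.{w} F' F' n} {ω : Ext.{w} (F ⊞ F') (F ⊞ F') n}
    (hnat : (Ext.mk₀ (biprod.inr : F' ⟶ F ⊞ F')).comp ω (zero_add n) = ωF'.comp (Ext.mk₀ biprod.inr) (add_zero n)) :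
    corner biprod.inr biprod.snd ω = ωF' :=
  corner_eq_of_natural biprod.inr_snd hnat

variable [HasFiniteBiproducts C] {ι' : Type} [Fintype ι'] {N : ι' → C} {n : ℕ}

/-- **Block-diagonal reconstruction:** a self-class of `⨁ N` natural along every injection `ι_a` (with classes `ω_a`)
is the sum of its diagonal blocks, `ω = Σ_a π_a ∘ ω_a ∘ ι_a`. [folklore] -/
theorem eq_sum_of_natural {ω : Ext.{w} (⨁ N) (⨁ N) n} {ωa : ∀ a, Ext.{w} (N a) (N a) n}
    (hnat : ∀ a, (Ext.mk₀ (biproduct.ι N a)).comp ω (zero_add n) =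
      (ωa a).comp (Ext.mk₀ (biproduct.ι N a)) (add_zero n)) :
    ω = ∑ a, (Ext.mk₀ (biproduct.π N a)).comp ((ωa a).comp (Ext.mk₀ (biproduct.ι N a)) (add_zero n)) (zero_add n) := by
  conv_lhs => rw [← Ext.mk₀_id_comp ω, ← biproduct.total, Ext.mk₀_sum, Ext.sum_comp]
  exact Finset.sum_congr rfl fun a _ => by rw [← Ext.mk₀_comp_mk₀_assoc, hnat a]

/-- **A split object is unobstructed iff every block is:** under naturality along the injections,
`ω = 0 ↔ ∀ a, ω_a = 0`. [folklore] -/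
theorem eq_zero_iff_of_natural {ω : Ext.{w} (⨁ N) (⨁ N) n} {ωa : ∀ a, Ext.{w} (N a) (N a) n}
    (hnat : ∀ a, (Ext.mk₀ (biproduct.ι N a)).comp ω (zero_add n) =
      (ωa a).comp (Ext.mk₀ (biproduct.ι N a)) (add_zero n)) :
    ω = 0 ↔ ∀ a, ωa a = 0 := by
  constructor
  · rintro rfl a
    rw [← corner_eq_of_natural (biproduct.ι_π_self N a) (hnat a), corner_zero]
  · intro h
    rw [eq_sum_of_natural hnat]
    exact Finset.sum_eq_zero fun a _ => by rw [h a, Ext.zero_comp, Ext.comp_zero]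

end Corner

/-! ## §2 The SHEAF door: `ob_κ` on `𝒪_X`-modules and the partial semiregularity map `σ_J` -/

section SheafDoor

universe w u

variable {k : Type u} [CommRing k] {X : Over (Spec (CommRingCat.of k))} [HasExt.{w} X.left.Modules]

/-- **Summand obstruction, sheaf door, general natural pair:** `G` finite locally free with a retract `F`
(`i ≫ r = 𝟙 F`), degree-2 self-classes natural along `i`, `ω_F ≠ 0`, and `σ_q(ω_G) = 0` for all `q ∈ J` (displayed
binder: [BuchweitzFlenner2003, Cor. 4.3] + «`κ` invisible on `ch(G)`») ⟹ `G` is not `J`-semiregular.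
[cite: BuchweitzFlenner2003, §5 (I-semiregular) and Cor. 4.3] -/
theorem not_isISemiregular_of_natural_retract {F G : X.left.Modules} (hG : IsFiniteLocallyFree G) {i : F ⟶ G}
    {r : G ⟶ F} (hir : i ≫ r = 𝟙 F) {ωF : Ext.{w} F F 2} {ωG : Ext.{w} G G 2}
    (hnat : (Ext.mk₀ i).comp ωG (zero_add 2) = ωF.comp (Ext.mk₀ i) (add_zero 2)) (hF : ωF ≠ 0) {J : Set ℕ}
    (hσ : ∀ q ∈ J, sigmaHigher hG q ωG = 0) : ¬ IsISemiregular hG J :=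
  fun hsr => ne_zero_of_natural_retract hir hnat hF (hsr ωG hσ)

/-- **Summand obstruction for `ob = At' ≫ c`** (any natural contraction `κ : Contraction X q`, `1 + q = 2`; naturality is
the tree's `Contraction.ob_natural`): `ob(F) ≠ 0` on a retract `F` of `G` and `σ_J(ob(G)) = 0` ⟹ `G` not `J`-semiregular.
[cite: BuchweitzFlenner2003, §5 (I-semiregular) and Cor. 4.3] -/
theorem not_isISemiregular_of_retract_ob {q : ℕ} (κ : Contraction.{w} X q) (h : 1 + q = 2) {F G : X.left.Modules}
    (hG : IsFiniteLocallyFree G) {i : F ⟶ G} {r : G ⟶ F} (hir : i ≫ r = 𝟙 F) (hF : κ.ob h F ≠ 0) {J : Set ℕ}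
    (hσ : ∀ p ∈ J, sigmaHigher hG p (κ.ob h G) = 0) : ¬ IsISemiregular hG J :=
  not_isISemiregular_of_natural_retract hG hir (κ.ob_natural h i) hF hσ

/-- **σ-certified form** (both hypotheses are values of the semiregularity map, i.e. on paper Chern-character
contractions: «`κ ⌟ ch_{p+1}(F) ≠ 0`» for the summand, «`κ ⌟ ch_{q+1}(G) = 0`, `q ∈ J`» for the total):
`σ_p(ob(F)) ≠ 0 ∧ σ_J(ob(G)) = 0 ⟹ G` not `J`-semiregular. This is the exact shape of LINE 1's kill (summand `S₀`,
`p = 2`, `c·θ³`). [cite: BuchweitzFlenner2003, Cor. 4.3 and §5] -/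
theorem not_isISemiregular_of_retract_sigma_ne {q : ℕ} (κ : Contraction.{w} X q) (h : 1 + q = 2)
    {F G : X.left.Modules} (hF : IsFiniteLocallyFree F) (hG : IsFiniteLocallyFree G) {i : F ⟶ G} {r : G ⟶ F}
    (hir : i ≫ r = 𝟙 F) {p : ℕ} (hp : sigmaHigher hF p (κ.ob h F) ≠ 0) {J : Set ℕ}
    (hσ : ∀ p ∈ J, sigmaHigher hG p (κ.ob h G) = 0) : ¬ IsISemiregular hG J :=
  not_isISemiregular_of_retract_ob κ h hG hir (fun h0 => hp (by rw [h0, map_zero])) hσ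

/-- **Summand obstruction for `ob_κ = At' ≫ c_κ` of an extension `κ : 0 → 𝒯 → 𝒦 → 𝒪_X → 0`** (the tree's `obExt`,
NO contraction hypothesis): `ob_κ(F) ≠ 0` on a retract and `σ_J(ob_κ(G)) = 0` ⟹ `G` not `J`-semiregular.
[cite: BuchweitzFlenner2003, §5 (I-semiregular) and Cor. 4.3] -/
theorem not_isISemiregular_of_retract_obExt {K : X.left.Modules} {ι : tangentSheaf X ⟶ K}
    {π : K ⟶ unitModule X.left} {w : ι ≫ π = 0} (hκ : (ShortComplex.mk ι π w).ShortExact) (h : 1 + 1 = 2)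
    {F G : X.left.Modules} (hG : IsFiniteLocallyFree G) {i : F ⟶ G} {r : G ⟶ F} (hir : i ≫ r = 𝟙 F)
    (hF : obExt hκ h F ≠ 0) {J : Set ℕ} (hσ : ∀ p ∈ J, sigmaHigher hG p (obExt hκ h G) = 0) :
    ¬ IsISemiregular hG J :=
  not_isISemiregular_of_retract_ob (Contraction.ofExtension hκ) h hG hir hF hσ

/-- **Binary direct sum, left block obstructed:** `ob(F) ≠ 0`, `σ_J(ob(F ⊞ F')) = 0` ⟹ `F ⊞ F'` not `J`-semiregular.
[cite: BuchweitzFlenner2003, §5 (I-semiregular)] -/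
theorem not_isISemiregular_biprod_of_inl {q : ℕ} (κ : Contraction.{w} X q) (h : 1 + q = 2) {F F' : X.left.Modules}
    (hG : IsFiniteLocallyFree (F ⊞ F')) (hF : κ.ob h F ≠ 0) {J : Set ℕ}
    (hσ : ∀ p ∈ J, sigmaHigher hG p (κ.ob h (F ⊞ F')) = 0) : ¬ IsISemiregular hG J :=
  not_isISemiregular_of_retract_ob κ h hG biprod.inl_fst hF hσ

/-- **Binary direct sum, right block obstructed.** [cite: BuchweitzFlenner2003, §5 (I-semiregular)] -/
theorem not_isISemiregular_biprod_of_inr {q : ℕ} (κ : Contraction.{w} X q) (h : 1 + q = 2) {F F' : X.left.Modules}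
    (hG : IsFiniteLocallyFree (F ⊞ F')) (hF' : κ.ob h F' ≠ 0) {J : Set ℕ}
    (hσ : ∀ p ∈ J, sigmaHigher hG p (κ.ob h (F ⊞ F')) = 0) : ¬ IsISemiregular hG J :=
  not_isISemiregular_of_retract_ob κ h hG biprod.inr_snd hF' hσ

variable [HasFiniteBiproducts X.left.Modules] {ι' : Type} [Fintype ι'] {N : ι' → X.left.Modules}

/-- **Finite direct sum, one block obstructed:** `ob(N_a) ≠ 0` for some `a`, `σ_J(ob(⨁ N)) = 0` ⟹ `⨁ N` not
`J`-semiregular (a disjoint union of carriers `𝒪_Z = ⊕ 𝒪_{Z_a}` is the case in point). [cite: BuchweitzFlenner2003, §5] -/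
theorem not_isISemiregular_biproduct_of_block {q : ℕ} (κ : Contraction.{w} X q) (h : 1 + q = 2)
    (hG : IsFiniteLocallyFree (⨁ N)) (a : ι') (ha : κ.ob h (N a) ≠ 0) {J : Set ℕ}
    (hσ : ∀ p ∈ J, sigmaHigher hG p (κ.ob h (⨁ N)) = 0) : ¬ IsISemiregular hG J :=
  not_isISemiregular_of_retract_ob κ h hG (biproduct.ι_π_self N a) ha hσ

/-- **A split design is unobstructed along `κ` iff every block is** (`ob = At' ≫ c`, any degree):
`ob(⨁ N) = 0 ↔ ∀ a, ob(N_a) = 0`. The model-level reading: a decomposable first-order design is SAT iff each block is.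
[folklore] -/
theorem ob_biproduct_eq_zero_iff {q n : ℕ} (κ : Contraction.{w} X q) (h : 1 + q = n) :
    κ.ob h (⨁ N) = 0 ↔ ∀ a, κ.ob h (N a) = 0 :=
  eq_zero_iff_of_natural fun a => κ.ob_natural h (biproduct.ι N a)

end SheafDoor

/-! ## §2b `σ(ob)` is additive over direct sums — the summand lemma with BOTH hypotheses as values of `σ`

This section uses the tree's GLOBAL instance `HasExt.{u+1} X.Modules` (registered in `HodgeTheory/SemiregularityMap`), because the
dinaturality theorems of `SemiregularityMapDinatural.lean` ([BF03, Cor. 4.8]) are stated with it; the polymorphic lemmas of §2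
specialise to it. -/

section SigmaAdditive

universe u

variable {k : Type u} [CommRing k] {X : Over (Spec (CommRingCat.of k))}

/-- **`σ(ob)` IS ADDITIVE OVER DIRECT SUMS** (kernel shadow of `κ ⌟ ch(F ⊞ F') = κ ⌟ ch(F) + κ ⌟ ch(F')`, with NO Chern
character in sight): `σ_p^{F ⊞ F'}(ob(F ⊞ F')) = σ_p^{F}(ob(F)) + σ_p^{F'}(ob(F'))` for every natural contraction and every `p`.
Proof: the tree's block splitting `sigmaHigher_biprod_eq_add` ([BF03, Cor. 4.8] dinaturality) + the corner identities
`inl ∘ ob(F ⊞ F') ∘ fst = ob(F)`, `inr ∘ ob(F ⊞ F') ∘ snd = ob(F')` (`Contraction.ob_natural`).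
[cite: BuchweitzFlenner2003, Cor. 4.8 (consequence) and Def. 4.1] -/
theorem sigmaHigher_ob_biprod_eq_add {q : ℕ} (κ : Contraction X q) (h : 1 + q = 2) {F F' : X.left.Modules}
    (hG : IsFiniteLocallyFree (F ⊞ F')) (hF : IsFiniteLocallyFree F) (hF' : IsFiniteLocallyFree F') (p : ℕ) :
    sigmaHigher hG p (κ.ob h (F ⊞ F')) = sigmaHigher hF p (κ.ob h F) + sigmaHigher hF' p (κ.ob h F') := by
  rw [sigmaHigher_biprod_eq_add hG hF hF' p, conj_eq_of_natural biprod.inl_fst (κ.ob_natural h biprod.inl),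
    conj_eq_of_natural biprod.inr_snd (κ.ob_natural h biprod.inr)]

/-- **THE SUMMAND OBSTRUCTION LEMMA** (the critic's sentence, idea-crit-6 g3: «a direct sum with a summand `S` with
`κ ⌟ ch(S) ≠ 0` is not `I`-semiregular whenever `κ ⌟ ch(total) = 0`», with `κ ⌟ ch_{p+1}(·)` read as `σ_p(ob_κ(·))`, [BF03, Cor. 4.3]
being the DISPLAYED dictionary and not a binder): if `σ_p(ob(F)) ≠ 0` for some `p` and `σ_q(ob(F ⊞ F')) = 0` for all `q ∈ J`,
then `F ⊞ F'` is not `J`-semiregular — for every natural contraction `κ`, every `J`, any `F'`.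
[cite: BuchweitzFlenner2003, §5 (I-semiregular), Cor. 4.3 and Cor. 4.8] -/
theorem not_isISemiregular_biprod_of_sigma_ne {q : ℕ} (κ : Contraction X q) (h : 1 + q = 2) {F F' : X.left.Modules}
    (hG : IsFiniteLocallyFree (F ⊞ F')) (hF : IsFiniteLocallyFree F) {p : ℕ} (hp : sigmaHigher hF p (κ.ob h F) ≠ 0)
    {J : Set ℕ} (hσ : ∀ q ∈ J, sigmaHigher hG q (κ.ob h (F ⊞ F')) = 0) : ¬ IsISemiregular hG J :=
  not_isISemiregular_of_retract_sigma_ne κ h hF hG biprod.inl_fst hp hσ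

/-- **NEG-form, by name: Weil-ness summand by summand, in ALL degrees.** If `F ⊞ F'` IS `J`-semiregular and its total obstruction
is `σ_J`-invisible, then `σ_p(ob(F)) = 0` for EVERY `p` (not only `p ∈ J`): «`κ ⌟ ch_{p+1}(F) = 0` for every `p` and every direct
summand `F`». [cite: BuchweitzFlenner2003, §5 (I-semiregular), Cor. 4.3 and Cor. 4.8] -/
theorem sigmaHigher_ob_summand_eq_zero_of_isISemiregular {q : ℕ} (κ : Contraction X q) (h : 1 + q = 2)
    {F F' : X.left.Modules} (hG : IsFiniteLocallyFree (F ⊞ F')) (hF : IsFiniteLocallyFree F) {J : Set ℕ}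
    (hsr : IsISemiregular hG J) (hσ : ∀ q ∈ J, sigmaHigher hG q (κ.ob h (F ⊞ F')) = 0) (p : ℕ) :
    sigmaHigher hF p (κ.ob h F) = 0 := by
  by_contra hp
  exact not_isISemiregular_biprod_of_sigma_ne κ h hG hF hp hσ hsr

/-- **Cancellation is forced and useless:** if the total is `σ_p`-invisible then the two summands' `σ_p(ob)` are opposite
(`σ_p(ob(F')) = −σ_p(ob(F))`), so a `κ`-visible summand is always "cancelled" by the rest — and by the lemma the sum is then never
`J`-semiregular for any `J`. [cite: BuchweitzFlenner2003, Cor. 4.8 (consequence)] -/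
theorem sigmaHigher_ob_summands_cancel {q : ℕ} (κ : Contraction X q) (h : 1 + q = 2) {F F' : X.left.Modules}
    (hG : IsFiniteLocallyFree (F ⊞ F')) (hF : IsFiniteLocallyFree F) (hF' : IsFiniteLocallyFree F') {p : ℕ}
    (hσp : sigmaHigher hG p (κ.ob h (F ⊞ F')) = 0) :
    sigmaHigher hF' p (κ.ob h F') = -sigmaHigher hF p (κ.ob h F) := by
  have hadd := sigmaHigher_ob_biprod_eq_add κ h hG hF hF' p
  rw [hσp] at hadd
  exact eq_neg_of_add_eq_zero_right hadd.symm

end SigmaAdditive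

/-! ## §3 The PERFECT-COMPLEX door: shifted corners in the derived category -/

section ShiftCorner

/-- **Shifted corner identity** (any category with a shift): for a retract `i : A → B`, `r : B → A`, `i ≫ r = 𝟙`, and
degree-`m` classes `ob_A : A → A⟦m⟧`, `ob_B : B → B⟦m⟧` natural along `i` (`i ≫ ob_B = ob_A ≫ i⟦m⟧`), the corner
`i ≫ ob_B ≫ r⟦m⟧` is `ob_A`. [folklore] -/
theorem shiftCorner_eq_of_natural {D : Type*} [Category D] {M : Type*} [AddMonoid M] [HasShift D M] {A B : D}
    {i : A ⟶ B} {r : B ⟶ A} (hir : i ≫ r = 𝟙 A) {m : M} {obA : A ⟶ A⟦m⟧} {obB : B ⟶ B⟦m⟧}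
    (hnat : i ≫ obB = obA ≫ i⟦m⟧') : i ≫ obB ≫ r⟦m⟧' = obA := by
  rw [← Category.assoc, hnat, Category.assoc, ← (shiftFunctor D m).map_comp, hir, (shiftFunctor D m).map_id,
    Category.comp_id]

/-- Hence `ob_A ≠ 0 ⇒ ob_B ≠ 0`. [folklore] -/
theorem shift_ne_zero_of_natural_retract {D : Type*} [Category D] [HasZeroMorphisms D] {M : Type*} [AddMonoid M]
    [HasShift D M] {A B : D} {i : A ⟶ B} {r : B ⟶ A} (hir : i ≫ r = 𝟙 A) {m : M} {obA : A ⟶ A⟦m⟧}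
    {obB : B ⟶ B⟦m⟧} (hnat : i ≫ obB = obA ≫ i⟦m⟧') (hA : obA ≠ 0) : obB ≠ 0 := by
  rintro rfl
  apply hA
  rw [← shiftCorner_eq_of_natural hir hnat, zero_comp, comp_zero]

end ShiftCorner

section ComplexDoor

universe w₁

variable (X₀ : SchemeOver ℂ) [HasDerivedCategory.{w₁} X₀.left.Modules] (K : CochainComplex X₀.left.Modules ℤ)

/-- **Summand obstruction, perfect-complex door, hypothesis form** (mirror of transfer's
`TorusSheafDoor.not_isISemiregularC_of_epsTraceInputs` with the ε-trace inputs replaced by a RETRACT): `A` a retract of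
`Q K•` in `D(X₀)`, degree-2 classes natural along the inclusion (displayed binder: naturality of `At` on `D(X₀)`),
`ob_A ≠ 0`, and `σ_q(ob_K) = 0` for `q ∈ J` ([BuchweitzFlenner2003, Cor. 4.3] binder) ⟹ `K•` is not `J`-semiregular.
[cite: BuchweitzFlenner2003, Def. 4.1, Cor. 4.3 and §5 (I-semiregular)] -/
theorem not_isISemiregularC_of_retract_obstructed (a b : ℤ) [K.IsStrictlyGE a] [K.IsStrictlyLE b]
    (hK : ∀ p, IsFiniteLocallyFree (K.X p)) {A : DerivedCategory X₀.left.Modules}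
    {i : A ⟶ DerivedCategory.Q.obj K} {r : DerivedCategory.Q.obj K ⟶ A} (hir : i ≫ r = 𝟙 A)
    {obA : A ⟶ A⟦(2 : ℤ)⟧} {obK : ShiftedHom (DerivedCategory.Q.obj K) (DerivedCategory.Q.obj K) (2 : ℤ)}
    (hnat : i ≫ obK = obA ≫ i⟦(2 : ℤ)⟧') (hA : obA ≠ 0) {J : Set ℕ}
    (hσ : ∀ q ∈ J, Summit.Ventures.HSemireg.HomComplex.sigmaC X₀ K a b hK q obK = 0) :
    ¬ Summit.Ventures.HSemireg.HomComplex.IsISemiregularC X₀ K a b hK J :=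
  fun hJ => shift_ne_zero_of_natural_retract hir hnat hA
    ((Summit.Ventures.HSemireg.HomComplex.isISemiregularC_iff_ker X₀ K a b hK J).1 hJ _ hσ)

end ComplexDoor

section ComplexDoorCorollary

variable {n : ℕ} {X₀ : SchemeOver ℂ} {I : Finset ℕ} {K : CochainComplex X₀.left.Modules ℤ}

/-- **Door form:** if for EVERY bounded locally-free presentation `[a, b]` of `K•` (they are presentation-independent on
paper) `K•` fails to be `{q | q + 1 ∈ I}`-semiregular — e.g. by `not_isISemiregularC_of_retract_obstructed` — then `K•` is
not `gluableSigmaAdmissible n X₀ I` (compare transfer's `TorusSheafDoor.not_gluableSigmaAdmissible_of_epsTraceInputs`,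
which asks this for all `J`). [cite: BuchweitzFlenner2003, §5 (I-semiregular)] -/
theorem not_gluableSigmaAdmissible_of_retracts
    (h : ∀ (a b : ℤ) (_ : K.IsStrictlyGE a) (_ : K.IsStrictlyLE b) (hK : ∀ p, IsFiniteLocallyFree (K.X p)),
      letI := HasDerivedCategory.standard X₀.left.Modules
      ¬ Summit.Ventures.HSemireg.HomComplex.IsISemiregularC X₀ K a b hK {q | q + 1 ∈ I}) :
    ¬ gluableSigmaAdmissible n X₀ I K := by
  rintro ⟨-, -, a, b, _, _, hK, hsr⟩
  exact h a b ‹_› ‹_› hK hsr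

end ComplexDoorCorollary

/-! ## §4 R-a «THEOREM DD ⊆ σ» in hypothesis form: one rank inequality forces injectivity (pure linear algebra) -/

section DDinSigma

variable {𝕜 : Type*} [DivisionRing 𝕜] {U V W : Type*} [AddCommGroup U] [Module 𝕜 U] [AddCommGroup V] [Module 𝕜 V]
  [AddCommGroup W] [Module 𝕜 W] [FiniteDimensional 𝕜 V]

/-- `rank(g ∘ f) ≤ dim V` («`h¹(N_Z) ≥ rank(κ ↦ κ ⌟ [Z]) = n(n+1)` for every W-alive lci `Z`»). [folklore] -/
theorem finrank_range_comp_le_finrank (f : U →ₗ[𝕜] V) (g : V →ₗ[𝕜] W) :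
    Module.finrank 𝕜 (LinearMap.range (g ∘ₗ f)) ≤ Module.finrank 𝕜 V := by
  rw [LinearMap.range_comp]
  exact (Submodule.finrank_map_le g (LinearMap.range f)).trans (Submodule.finrank_le _)

/-- **R-a:** `dim V ≤ rank(g ∘ f)` forces `g` injective and `f` surjective («THEOREM DD's hypothesis
`h¹(N_Z) ≤ n² + n` forces `ob_Z` onto `H¹(N_Z)` and Bloch's `σ_Z` injective, i.e. `Z` Bloch-semiregular»).
[cite: Bloch1972, §4–7] [cite: BuchweitzFlenner2003, Cor. 4.3] -/
theorem injective_and_surjective_of_finrank_le_finrank_range_comp (f : U →ₗ[𝕜] V) (g : V →ₗ[𝕜] W)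
    (hle : Module.finrank 𝕜 V ≤ Module.finrank 𝕜 (LinearMap.range (g ∘ₗ f))) :
    Function.Injective g ∧ Function.Surjective f := by
  have hf : Module.finrank 𝕜 (LinearMap.range (g ∘ₗ f)) ≤ Module.finrank 𝕜 (LinearMap.range f) := by
    rw [LinearMap.range_comp]
    exact Submodule.finrank_map_le g (LinearMap.range f)
  have hg : Module.finrank 𝕜 (LinearMap.range (g ∘ₗ f)) ≤ Module.finrank 𝕜 (LinearMap.range g) :=
    Submodule.finrank_mono (LinearMap.range_comp_le_range f g)
  have hrk := LinearMap.finrank_range_add_finrank_ker g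
  refine ⟨?_, ?_⟩
  · have hker : Module.finrank 𝕜 (LinearMap.ker g) = 0 := by omega
    rw [← LinearMap.ker_eq_bot]
    exact Submodule.finrank_eq_zero.mp hker
  · rw [← LinearMap.range_eq_top]
    exact Submodule.eq_top_of_finrank_eq (le_antisymm (Submodule.finrank_le _) (hle.trans hf))

end DDinSigma

end Summit.HodgeConjecture.HodgeConjecture.Cruxes.BlochSeedDiscOne.SummandObstruction

end
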